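/-
Copyright (c) 2026. All rights reserved.
Released under Apache 2.0 license as described in the file LICENSE.
-/
import Summits.Langlands.Langlands.Theorems.SoloInformedTateFamilyDeRham
import Literature.NumberTheory.Automorphic.LocalLanglandsGLOne
import Literature.NumberTheory.Automorphic.CuspidalTwistLocalComponent
import Literature.NumberTheory.Automorphic.HeckeCharacterLocalComponentSmooth
import Literature.NumberTheory.GaloisRepresentations.GrothendieckDeligneWeilDeligneExistenceHolds
import Literature.NumberTheory.GaloisRepresentations.WeilDeligneOfGaloisUnramifiedProofs
import Literature.NumberTheory.GaloisRepresentations.HeckeCharacterNormTwistProofs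
import Literature.NumberTheory.EllipticCurves.ZpExtensionLayersLocalSymbolProofs
import HarnessLib

/-!
# Local–global compatibility of the Tate family `(π_{‖·‖^k}, χ_ℓ^k)` at every `v ∤ ℓ`; the summit's content on
# `π_{‖·‖^k}` is the pinned `v ∣ ℓ` clause alone (rung Λ19)

Programme `solo-Langlands-informed` (statement analysis of `Summit.Langlands`).  Rung Λ18
(`SoloInformedTateFamilyDeRham`) reduced the (A)-existence clause of the typed summit at the L-algebraic cuspidal
representation `π_{‖·‖^k} = ℂ·‖det‖^k/⊥` of `GL₁(𝔸_K)` to local–global compatibility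
`∀ v, LocalGlobalCompatibleAt 𝓡 ι π_{‖·‖^k} χ_ℓ^k v` (`exists_corresponds_normPow_iff_localGlobalCompatibleAt`).
This file PROVES that compatibility at every finite place `v ∤ ℓ`, for every reciprocity datum `𝓡`, every
`ι : ℚ̄_ℓ ≃ ℂ` and every `k : ℕ`, on genuine terms on both sides:

* §1 (automorphic side, any Hecke character `θ`) the local component of `π_θ = ℂ·(θ∘det)/⊥` at `v` is the
  character `θ_v ∘ det` of `GL₁(K_v)` (`hasLocalComponentAt_ofQuasiChar_localComponent`: the line
  `c ↦ c·(θ∘det)` is `GL₁(K_v)`-equivariant, `(θ∘det)(g·ι_v h) = (θ∘det)(g)·θ_v(det h)`), and `rec₁` of ANY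
  `𝓡` sends it to the class of `(θ_v ∘ Art_v, N = 0)` (`recGL_one_ofQuasiChar`, Harris–Taylor Thm. A (i));
  for `θ = ‖·‖^k`: `θ_v(Art_v w) = q_v^{k·deg w}` (`localQuasiChar_normPow_artin`: the PINNED Artin map sends a
  geometric Frobenius to a uniformiser, `ArtinLocalGlobal.valued_artin_eq_exp_deg`, and `‖ϖ_v‖ = q_v⁻¹`).
* §2 (Galois side) `χ_ℓ^k|W_{K_v}` is unramified with `det χ_ℓ^k(w) = q_v^{k·deg w}`
  (`toWeilGroupHom_twist_one_tateChar_apply_coe`: `χ_ℓ(Frob_v) = q_v`, tree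
  `GaloisRep.cyclotomicCharacter_apply_of_isArithFrobAt`, and `W_{K_v} = Frob^ℤ · I_{K_v}`), so the
  Grothendieck–Deligne recipe (tree `GrothendieckDeligne_exists_isWeilDeligneOfLadic_holds`) returns
  `(χ_ℓ^k|W_{K_v}, N = 0)` itself (`IsWeilDeligneOfLadic.toMatrix'_ρ_eq_of_forall_inertia`).
* §3 ★★ `localGlobalCompatibleAt_normPow_tateChar_away`: `LocalGlobalCompatibleAt 𝓡 ι π_{‖·‖^k} χ_ℓ^k v` at every
  `v ∤ ℓ` — the two sides are transported into each other by `ι` because both scalars are the RATIONAL number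
  `q_v^{k·deg w}`.  Hence ★★★ `exists_corresponds_normPow_iff_above`: for every `𝓡`, `ι`, `k`, the summit's
  (A)-existence statement at `π_{‖·‖^k}` is equivalent to `∀ v ∣ ℓ, LocalGlobalCompatibleAt 𝓡 ι π_{‖·‖^k} χ_ℓ^k v`,
  and (`localGlobalCompatibleAt_normPow_above_of_pst`) at such `v` the clause is implied by its pinned `p`-adic
  Hodge conjunct ALONE: `∃ r rℂ, (𝓡.pst ℓ v hv).IsWeilDeligneOf (χ_ℓ^k|Γ_{K_v}) r ∧ r ~ι rℂ ∧
  rℂ^{F-ss} ∈ [(‖·‖_v^k ∘ Art_v, 0)]` — the local component and its `rec₁` having been computed (§1).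
  On the Tate family the typed summit `Summit.Langlands` therefore asserts nothing beyond theorems of the tree
  except about the value of the Weil–Deligne functor of the pinned datum `fontainePstAdicCompletion v ℓ hv` on the
  infinitely ramified characters `χ_ℓ^k|Γ_{K_v}`, `k ≥ 1` (for `k = 0` the clause is decided: rungs Λ14/Λ15).

No new definitions; no period-ring mathematics.

References: Tate, *Number theoretic background*, Proc. Sympos. Pure Math. 33 (1979), part 2, (1.4.1), (4.1.3),
(4.2.1); Harris–Taylor, Ann. of Math. Stud. 151 (2001), Thm. A (i); Serre, *Abelian ℓ-adic representations and
elliptic curves* (1968), Ch. I §1.2; Deligne, *Les constantes des équations fonctionnelles des fonctions L*, LNM 349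
(1973), §8.4; Buzzard–Gee, LMS LNS 414 (2014), Conj. 3.2.1–3.2.2, Rem. 3.2.5; Borel–Jacquet, Proc. Sympos. Pure
Math. 33 (1979), part 1, 4.6.
-/

noncomputable section

open scoped MatrixGroups Matrix Classical NumberField
open NumberField IsDedekindDomain Field Filter
open Literature.NumberTheory.Automorphic Literature.NumberTheory.GaloisRepresentations

namespace Summit.Langlands.Langlands.Theorems

namespace GLOneRigidity

variable {K : Type} [Field K] [NumberField K]

/-! ### §1 Automorphic side: the local component of `π_θ` at `v` is `θ_v ∘ det`, and its `rec₁` -/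

section Automorphic

variable {hcpt : isCompact_glFiniteIntegralLevel 1 K}

/-- ★ **The local component of `π_θ = ℂ·(θ∘det)/⊥` at `v` is the character `θ_v ∘ det` of `GL₁(K_v)`**
(`θ_v = θ ∘ ι_v`, `HeckeCharacter.localComponent`, continuous by `HeckeCharacter.continuous_localComponent`): the
line `c ↦ c·(θ∘det) ⊆ W` is a non-zero `GL₁(K_v)`-equivariant map from `SmoothIrrep.ofQuasiChar θ_v` to `W/⊥`,
since `(θ∘det)(g · ι_v h) = (θ∘det)(g) · θ_v(det h)` (`detTwist_ofLocal`).
[cite: BorelJacquet1979, 4.6] [cite: TateThesis1967, §4.3] -/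
theorem hasLocalComponentAt_ofQuasiChar_localComponent (θ : HeckeCharacter K)
    {π : AutomorphicRepData (AutomorphyDatum.gl 1 K hcpt)}
    (hW : π.W = Submodule.span ℂ {fun g : (AdelicGroupData.gl 1 K).Adelic => (detTwist 1 θ g : ℂ)})
    (hW' : π.W' = ⊥) (v : HeightOneSpectrum (𝓞 K)) :
    π.HasLocalComponentAt v
      (SmoothIrrep.ofQuasiChar
        (⟨θ.localComponent v, θ.continuous_localComponent v⟩ : QuasiChar (v.adicCompletion K))).ρ := by
  -- the representation space of `SmoothIrrep.ofQuasiChar θ_v` is `ℂ`, the action `glOneRep θ_v`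
  show π.HasLocalComponentAt v (V := ℂ) (glOneRep (θ.localComponent v))
  set φ : (AdelicGroupData.gl 1 K).Adelic → ℂ := fun g => (detTwist 1 θ g : ℂ) with hφ
  have hf : ∀ y : ℂ, LinearMap.toSpanSingleton ℂ ((AdelicGroupData.gl 1 K).Adelic → ℂ) φ y = y • φ :=
    fun y => rfl
  refine ⟨LinearMap.toSpanSingleton ℂ _ φ, ?_, ?_, fun g x => ?_⟩
  · rw [hW]
    rintro _ ⟨c, rfl⟩
    rw [hf]
    exact Submodule.smul_mem _ c (Submodule.subset_span (Set.mem_singleton φ))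
  · rw [hW']
    intro h
    have h1 := (Submodule.mem_bot ℂ).mp (h (LinearMap.mem_range_self _ (1 : ℂ)))
    rw [hf, one_smul] at h1
    have h2 := congr_fun h1 1
    rw [hφ] at h2
    dsimp only at h2
    rw [Pi.zero_apply, map_one, Units.val_one] at h2
    exact one_ne_zero h2
  · rw [hW', Submodule.mem_bot, sub_eq_zero, glOneRep_apply, hf, hf]
    funext g'
    simp only [Pi.smul_apply, smul_eq_mul, rightTranslation_apply]
    -- `(θ∘det)(g' · ι_v g) = (θ∘det)(g') · θ_v(det g)`
    rw [hφ]
    dsimp only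
    rw [map_mul, Units.val_mul, detTwist_ofLocal]
    ring

/-- ★ **`rec₁` of every reciprocity datum at `v` sends `θ_v ∘ det` to the class of `(θ_v ∘ Art_v, N = 0)`**
(`Art_v = (𝓡.llc v).artin.artin`, the pinned local Artin map): Harris–Taylor Thm. A (i) (`rec₁` = local class
field theory, tree `IsLocalLanglandsGL.rec_one_mk`). [cite: HarrisTaylorAMS2001, Thm. A (i)] -/
theorem recGL_one_ofQuasiChar (𝓡 : ReciprocityData K) (v : HeightOneSpectrum (𝓞 K))
    (χ : QuasiChar (v.adicCompletion K)) :
    (𝓡.llc v).recGL 1 (IrrClass.mk (SmoothIrrep.ofQuasiChar χ)) =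
      Quotient.mk _ ⟨WeilDeligneRep.ofQuasiCharOn (Fin 1 → ℂ) (𝓡.llc v).hns (𝓡.llc v).artin χ,
        WeilDeligneRep.isFrobSemisimple_ofQuasiCharOn (𝓡.llc v).hns (𝓡.llc v).artin χ⟩ :=
  (𝓡.llc v).isLocalLanglands.rec_one_mk (SmoothIrrep.ofQuasiChar_ρ_apply χ)

/-- The pinned local Artin map of a reciprocity datum has the characterising clauses of THE local Artin map
(`llc_isCanonical`, tree `isLocalArtinMap_canonicalArtin_holds`). [cite: SerreLocalFields1979, Ch. XIII §4 Thm. 1–2] -/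
theorem isLocalArtinMap_llc_artin (𝓡 : ReciprocityData K) (v : HeightOneSpectrum (𝓞 K)) :
    IsLocalArtinMap (v.adicCompletion K) (𝓡.llc v).artin.artin := by
  rw [show (𝓡.llc v).artin.artin = canonicalArtin (v.adicCompletion K) from 𝓡.llc_isCanonical v]
  exact isLocalArtinMap_canonicalArtin_holds (F := v.adicCompletion K)

/-- `(a^d)^k = (a^k)^d` for `d : ℤ`, `k : ℕ`. [folklore] -/
private theorem zpow_pow_comm (a : ℂ) (d : ℤ) (k : ℕ) : (a ^ d) ^ k = (a ^ k) ^ d := by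
  rw [← zpow_natCast, ← zpow_mul, zpow_mul', zpow_natCast]

/-- ★ **`‖Art_v(w)‖_v^k = q_v^{k·deg w}`**: the local component of `‖·‖^k` at `v`, evaluated on the pinned local
Artin map, is `w ↦ (q_v^k)^{deg w}` — `|Art_v(w)|_v = q_v^{deg w}` (`ArtinLocalGlobal.valued_artin_eq_exp_deg`:
geometric Frobenius ↦ uniformiser, inertia ↦ units; Tate (1.4.1)) and `‖·‖(ι_v x) = ‖x‖_v`
(`ideleNorm_localUnits`). [cite: TateCorvallis1979, (1.4.1)] [cite: TateThesis1967, §4.3] -/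
theorem localQuasiChar_normPow_artin (𝓡 : ReciprocityData K) (k : ℕ) (v : HeightOneSpectrum (𝓞 K))
    (w : WeilGroup (v.adicCompletion K)) :
    (((⟨(HeckeCharacter.normCharacter K ^ k).localComponent v,
          (HeckeCharacter.normCharacter K ^ k).continuous_localComponent v⟩ : QuasiChar (v.adicCompletion K))
        ((𝓡.llc v).artin.artin w) : ℂˣ) : ℂ) =
      ((v.residueCard : ℂ) ^ k) ^ WeilGroup.deg w := by
  change ((((HeckeCharacter.normCharacter K ^ k) (localUnits v ((𝓡.llc v).artin.artin w)) : ℂˣ) : ℂ)) = _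
  rw [HeckeCharacter.pow_apply, Units.val_pow_eq_pow_val, HeckeCharacter.normCharacter_apply, ideleNorm_localUnits,
    NumberField.FinitePlace.norm_def, ArtinLocalGlobal.valued_artin_eq_exp_deg v (isLocalArtinMap_llc_artin 𝓡 v) w,
    WithZero.exp, WithZeroMulInt.toNNReal_neg_apply _ WithZero.coe_ne_zero, WithZero.unzero_coe, toAdd_ofAdd,
    NNReal.coe_zpow, NNReal.coe_natCast, Complex.ofReal_zpow, Complex.ofReal_natCast, zpow_pow_comm]
  rfl

end Automorphic

/-! ### §2 Galois side: `χ_ℓ^k` on `W_{K_v}`, `v ∤ ℓ` -/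

section Galois

variable {ℓ : ℕ} [Fact ℓ.Prime]

omit [NumberField K] in
/-- `det (𝟙 ⊗ χ_ℓ^k)(σ) = χ_ℓ^k(σ)`. [folklore] -/
theorem det_twist_one_tateChar (k : ℕ) (σ : absoluteGaloisGroup K) :
    Matrix.GeneralLinearGroup.det
        (FramedRep.twist (1 : FramedGaloisRep K (PadicAlgCl ℓ) 1) (D2Cris.tateChar K ℓ k) σ) =
      D2Cris.tateChar K ℓ k σ := by
  rw [FramedRep.det_twist_apply, pow_one, ContinuousMonoidHom.coe_one, Pi.one_apply, map_one, mul_one]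

/-- ★ **`det χ_ℓ^k(w) = (q_v^k)^{deg w}` on `W_{K_v}`, `v ∤ ℓ`** (the entry of the `1 × 1` matrix
`(𝟙 ⊗ χ_ℓ^k)|W_{K_v}(w)`): write `w = u^{deg w} · i` with `deg u = 1` and `i` inert
(`ArtinLocalGlobal.exists_eq_zpow_mul_inertia`); `u` restricts to an arithmetic Frobenius at the prime `𝔓₀ ∣ v`
cut out by `K̄ → K̄_v` (`ArtinLocalGlobal.isArithFrobAt_of_deg_eq_one`), where `χ_ℓ = q_v`
(`GaloisRep.cyclotomicCharacter_apply_of_isArithFrobAt`), and `χ_ℓ^k` is unramified at `v`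
(Λ15 `D2Cris.isUnramifiedAt_twist_one_tateChar`). [cite: SerreAbelianLadic1968, Ch. I §1.2 (Example: the cyclotomic character)]
[cite: TateCorvallis1979, (1.4.1)] -/
theorem toWeilGroupHom_twist_one_tateChar_apply_coe (k : ℕ) {v : HeightOneSpectrum (𝓞 K)}
    (hv : ((ℓ : ℕ) : 𝓞 K) ∉ v.asIdeal) (w : WeilGroup (v.adicCompletion K)) :
    (((FramedGaloisRep.toLocal v
          (FramedRep.twist (1 : FramedGaloisRep K (PadicAlgCl ℓ) 1) (D2Cris.tateChar K ℓ k))).toWeilGroupHom w :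
        GL (Fin 1) (PadicAlgCl ℓ)) : Matrix (Fin 1) (Fin 1) (PadicAlgCl ℓ)) 0 0 =
      ((v.residueCard : PadicAlgCl ℓ) ^ k) ^ WeilGroup.deg w := by
  -- the `1 × 1` entry is the determinant of `ρW(w)`, `ρW = χ_ℓ^k|W_{K_v}` a homomorphism to `GL₁(ℚ̄_ℓ)`
  rw [← Matrix.det_fin_one (((FramedGaloisRep.toLocal v
      (FramedRep.twist (1 : FramedGaloisRep K (PadicAlgCl ℓ) 1) (D2Cris.tateChar K ℓ k))).toWeilGroupHom w :
        GL (Fin 1) (PadicAlgCl ℓ)) : Matrix (Fin 1) (Fin 1) (PadicAlgCl ℓ)),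
    ← Matrix.GeneralLinearGroup.val_det_apply]
  have hI := FramedGaloisRep.toWeilGroupHom_toLocal_eq_one_of_isUnramifiedAt
    (FramedRep.twist (1 : FramedGaloisRep K (PadicAlgCl ℓ) 1) (D2Cris.tateChar K ℓ k))
    (D2Cris.isUnramifiedAt_twist_one_tateChar k hv)
  obtain ⟨u, hu⟩ := ArtinLocalGlobal.exists_deg_eq_one v
  obtain ⟨i, hi, hw⟩ := ArtinLocalGlobal.exists_eq_zpow_mul_inertia v hu w
  -- `det ρW(u) = q_v^k`: `u` restricts to an arithmetic Frobenius at `𝔓₀ ∣ v`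
  have hu1 : ((Matrix.GeneralLinearGroup.det
      ((FramedGaloisRep.toLocal v
          (FramedRep.twist (1 : FramedGaloisRep K (PadicAlgCl ℓ) 1) (D2Cris.tateChar K ℓ k))).toWeilGroupHom u) :
        (PadicAlgCl ℓ)ˣ) : PadicAlgCl ℓ) = (v.residueCard : PadicAlgCl ℓ) ^ k := by
    rw [FramedRep.toWeilGroupHom_apply, FramedGaloisRep.toLocal_apply, det_twist_one_tateChar, D2Cris.coe_tateChar,
      D2Cris.cycQp,
      GaloisRep.cyclotomicCharacter_apply_of_isArithFrobAt hv (adicCompletionPrime_mem_primesAbove K v)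
        (ArtinLocalGlobal.isArithFrobAt_of_deg_eq_one v hu),
      PadicInt.coe_natCast, map_pow, map_natCast]
  conv_lhs => rw [hw]
  rw [map_mul, map_mul, hI i hi, map_one, mul_one, map_zpow, map_zpow, Units.val_zpow_eq_zpow_val, hu1]

end Galois

/-! ### §3 Local–global compatibility of `(π_{‖·‖^k}, χ_ℓ^k)` at every `v ∤ ℓ`; the residue at `v ∣ ℓ` -/

section NormPow

variable {hcpt : isCompact_glFiniteIntegralLevel 1 K} {ℓ : ℕ} [Fact ℓ.Prime]

/-- ★★ **Local–global compatibility of the Tate pair at every `v ∤ ℓ`**, for EVERY reciprocity datum `𝓡`, every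
`ι : ℚ̄_ℓ ≃ ℂ`, every `k`: the local component `‖·‖_v^k ∘ det` of `π_{‖·‖^k}` (§1) is sent by `rec₁` to
`(‖·‖_v^k ∘ Art_v, 0)`, the Grothendieck–Deligne recipe attaches `(χ_ℓ^k|W_{K_v}, 0)` to the unramified
`χ_ℓ^k|Γ_{K_v}` (tree `GrothendieckDeligne_exists_isWeilDeligneOfLadic_holds`,
`IsWeilDeligneOfLadic.toMatrix'_ρ_eq_of_forall_inertia`), and `ι` transports the one into the other because both
act on `w` by the rational scalar `q_v^{k·deg w}` (§1 `localQuasiChar_normPow_artin`, §2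
`toWeilGroupHom_twist_one_tateChar_apply_coe`); the `v ∣ ℓ` clause is vacuous.
[cite: BuzzardGeeLMS2014, Conj. 3.2.1 and Rem. 3.2.5] [cite: TateCorvallis1979, (4.1.3)–(4.2.1)]
[cite: HarrisTaylorAMS2001, Thm. A (i)] -/
theorem localGlobalCompatibleAt_normPow_tateChar_away (𝓡 : ReciprocityData K) (ι : PadicAlgCl ℓ ≃+* ℂ) (k : ℕ)
    {π : AutomorphicRepData (AutomorphyDatum.gl 1 K hcpt)}
    (hW : π.W = Submodule.span ℂ
      {fun g : (AdelicGroupData.gl 1 K).Adelic => (detTwist 1 (HeckeCharacter.normCharacter K ^ k) g : ℂ)})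
    (hW' : π.W' = ⊥) {v : HeightOneSpectrum (𝓞 K)} (hv : ((ℓ : ℕ) : 𝓞 K) ∉ v.asIdeal) :
    LocalGlobalCompatibleAt 𝓡 ι π
      (FramedRep.twist (1 : FramedGaloisRep K (PadicAlgCl ℓ) 1) (D2Cris.tateChar K ℓ k)) v := by
  obtain ⟨r, hr⟩ := GrothendieckDeligne_exists_isWeilDeligneOfLadic.toLocal
    GrothendieckDeligne_exists_isWeilDeligneOfLadic_holds K 1 ℓ
    (FramedRep.twist (1 : FramedGaloisRep K (PadicAlgCl ℓ) 1) (D2Cris.tateChar K ℓ k)) v hv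
  have hI := FramedGaloisRep.toWeilGroupHom_toLocal_eq_one_of_isUnramifiedAt
    (FramedRep.twist (1 : FramedGaloisRep K (PadicAlgCl ℓ) 1) (D2Cris.tateChar K ℓ k))
    (D2Cris.isUnramifiedAt_twist_one_tateChar k hv)
  have hN : r.N = 0 := hr.N_eq_zero_of_forall_inertia hI
  refine ⟨SmoothIrrep.ofQuasiChar
      (⟨(HeckeCharacter.normCharacter K ^ k).localComponent v,
        (HeckeCharacter.normCharacter K ^ k).continuous_localComponent v⟩ : QuasiChar (v.adicCompletion K)),
    r,
    WeilDeligneRep.ofQuasiCharOn (Fin 1 → ℂ) (𝓡.llc v).hns (𝓡.llc v).artin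
      (⟨(HeckeCharacter.normCharacter K ^ k).localComponent v,
        (HeckeCharacter.normCharacter K ^ k).continuous_localComponent v⟩ : QuasiChar (v.adicCompletion K)),
    hasLocalComponentAt_ofQuasiChar_localComponent _ hW hW' v, fun _ => hr, fun hv' => absurd hv' hv,
    ⟨fun w => ?_, ?_⟩, ?_⟩
  · -- the two `1 × 1` matrices: `‖Art_v w‖^k = ι((q_v^k)^{deg w})`
    rw [hr.toMatrix'_ρ_eq_of_forall_inertia hI w]
    have hℂ : (WeilDeligneRep.ofQuasiCharOn (Fin 1 → ℂ) (𝓡.llc v).hns (𝓡.llc v).artin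
          (⟨(HeckeCharacter.normCharacter K ^ k).localComponent v,
            (HeckeCharacter.normCharacter K ^ k).continuous_localComponent v⟩ :
              QuasiChar (v.adicCompletion K))).ρ w =
        (((⟨(HeckeCharacter.normCharacter K ^ k).localComponent v,
              (HeckeCharacter.normCharacter K ^ k).continuous_localComponent v⟩ :
                QuasiChar (v.adicCompletion K)) ((𝓡.llc v).artin.artin w) : ℂˣ) : ℂ) • LinearMap.id :=
      LinearMap.ext fun x => rfl
    rw [hℂ, map_smul, LinearMap.toMatrix'_id]
    ext i j
    obtain rfl : i = 0 := Subsingleton.elim _ _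
    obtain rfl : j = 0 := Subsingleton.elim _ _
    rw [Matrix.smul_apply, Matrix.one_apply_eq, smul_eq_mul, mul_one, Matrix.map_apply,
      toWeilGroupHom_twist_one_tateChar_apply_coe k hv w, map_zpow₀, map_pow, map_natCast,
      localQuasiChar_normPow_artin 𝓡 k v w]
  · rw [WeilDeligneRep.ofQuasiCharOn_N, hN, map_zero, map_zero, Matrix.map_zero _ (map_zero _)]
  · rw [recGL_one_ofQuasiChar]
    exact (WeilDeligneRep.isFrobSemisimple_ofQuasiCharOn _ _ _).hasFrobSemisimpleClass

/-- ★★★ **On the Tate family the summit's (A)-existence statement is the `v ∣ ℓ` clause alone.**  For every `𝓡`,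
`ι`, `k`: `(∃ ρ, IsGeometricFramed 𝓡 ρ ∧ Corresponds 𝓡 ι π_{‖·‖^k} ρ) ↔ ∀ v ∣ ℓ, LocalGlobalCompatibleAt 𝓡 ι π_{‖·‖^k} χ_ℓ^k v`
(Λ18 `exists_corresponds_normPow_iff_localGlobalCompatibleAt` and `localGlobalCompatibleAt_normPow_tateChar_away`).
[cite: BuzzardGeeLMS2014, Conj. 3.2.1 and Conj. 3.2.2] [cite: TaylorGaloisRepresentations2004, Conj. 7] -/
theorem exists_corresponds_normPow_iff_above (𝓡 : ReciprocityData K) (ι : PadicAlgCl ℓ ≃+* ℂ) (k : ℕ)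
    {π : AutomorphicRepData (AutomorphyDatum.gl 1 K hcpt)}
    (hW : π.W = Submodule.span ℂ
      {fun g : (AdelicGroupData.gl 1 K).Adelic => (detTwist 1 (HeckeCharacter.normCharacter K ^ k) g : ℂ)})
    (hW' : π.W' = ⊥) :
    (∃ ρ : FramedGaloisRep K (PadicAlgCl ℓ) 1, IsGeometricFramed 𝓡 ρ ∧ Corresponds 𝓡 ι π ρ) ↔
      ∀ v : HeightOneSpectrum (𝓞 K), ((ℓ : ℕ) : 𝓞 K) ∈ v.asIdeal →
        LocalGlobalCompatibleAt 𝓡 ι π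
          (FramedRep.twist (1 : FramedGaloisRep K (PadicAlgCl ℓ) 1) (D2Cris.tateChar K ℓ k)) v := by
  rw [exists_corresponds_normPow_iff_localGlobalCompatibleAt 𝓡 ι k hW hW']
  refine ⟨fun h v _ => h v, fun h v => ?_⟩
  by_cases hv : ((ℓ : ℕ) : 𝓞 K) ∈ v.asIdeal
  · exact h v hv
  · exact localGlobalCompatibleAt_normPow_tateChar_away 𝓡 ι k hW hW' hv

/-- ★★★ **… and at `v ∣ ℓ` the clause is its pinned `p`-adic Hodge conjunct.**  For `v ∣ ℓ`,
`LocalGlobalCompatibleAt 𝓡 ι π_{‖·‖^k} χ_ℓ^k v` is implied by — and, granted Flath uniqueness of local components and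
the injectivity of `rec₁`, equivalent to — the existence of a Weil–Deligne representation `r` over `ℚ̄_ℓ` with
`(𝓡.pst ℓ v hv).IsWeilDeligneOf (χ_ℓ^k|Γ_{K_v}) r` whose `ι`-transport has Frobenius-semisimple class
`[(‖·‖_v^k ∘ Art_v, 0)]`: the automorphic half of the clause is supplied by §1 unconditionally.  This is the
exact residue of the typed summit on the Tate family: a statement about the value of the Weil–Deligne functor of the
pinned `fontainePstAdicCompletion v ℓ hv` on the infinitely ramified character `χ_ℓ^k|Γ_{K_v}`.
[cite: BuzzardGeeLMS2014, Conj. 3.2.2] [cite: FontaineAsterisque223VIII, Exp. VIII §2.3.7] -/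
theorem localGlobalCompatibleAt_normPow_above_of_pst (𝓡 : ReciprocityData K) (ι : PadicAlgCl ℓ ≃+* ℂ) (k : ℕ)
    {π : AutomorphicRepData (AutomorphyDatum.gl 1 K hcpt)}
    (hW : π.W = Submodule.span ℂ
      {fun g : (AdelicGroupData.gl 1 K).Adelic => (detTwist 1 (HeckeCharacter.normCharacter K ^ k) g : ℂ)})
    (hW' : π.W' = ⊥) {v : HeightOneSpectrum (𝓞 K)} (hv : ((ℓ : ℕ) : 𝓞 K) ∈ v.asIdeal)
    (hpst : ∃ (r : WeilDeligneRep (v.adicCompletion K) (PadicAlgCl ℓ) (Fin 1 → PadicAlgCl ℓ))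
        (rℂ : WeilDeligneRep (v.adicCompletion K) ℂ (Fin 1 → ℂ)),
      (𝓡.pst ℓ v hv).IsWeilDeligneOf
          (FramedGaloisRep.toLocal v
            (FramedRep.twist (1 : FramedGaloisRep K (PadicAlgCl ℓ) 1) (D2Cris.tateChar K ℓ k))) r ∧
        r.IsTransportAlong (ι : PadicAlgCl ℓ →+* ℂ) rℂ ∧
        rℂ.HasFrobSemisimpleClass
          (Quotient.mk _ ⟨WeilDeligneRep.ofQuasiCharOn (Fin 1 → ℂ) (𝓡.llc v).hns (𝓡.llc v).artin
              (⟨(HeckeCharacter.normCharacter K ^ k).localComponent v,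
                (HeckeCharacter.normCharacter K ^ k).continuous_localComponent v⟩ : QuasiChar (v.adicCompletion K)),
            WeilDeligneRep.isFrobSemisimple_ofQuasiCharOn (𝓡.llc v).hns (𝓡.llc v).artin _⟩)) :
    LocalGlobalCompatibleAt 𝓡 ι π
      (FramedRep.twist (1 : FramedGaloisRep K (PadicAlgCl ℓ) 1) (D2Cris.tateChar K ℓ k)) v := by
  obtain ⟨r, rℂ, hpst, htr, hcl⟩ := hpst
  refine ⟨SmoothIrrep.ofQuasiChar
      (⟨(HeckeCharacter.normCharacter K ^ k).localComponent v,
        (HeckeCharacter.normCharacter K ^ k).continuous_localComponent v⟩ : QuasiChar (v.adicCompletion K)),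
    r, rℂ, hasLocalComponentAt_ofQuasiChar_localComponent _ hW hW' v, fun hv' => absurd hv hv',
    fun _ => hpst, htr, ?_⟩
  rw [recGL_one_ofQuasiChar]
  exact hcl

end NormPow

end GLOneRigidity

end Summit.Langlands.Langlands.Theorems

end
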